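import Mathlib.Analysis.Complex.TaylorSeries
import Mathlib.Analysis.Complex.RemovableSingularity
import Mathlib.Analysis.Calculus.Deriv.Star
import Mathlib.Analysis.Calculus.Deriv.ZPow
import Mathlib.Analysis.Calculus.IteratedDeriv.Lemmas
import Mathlib.Analysis.SpecialFunctions.Complex.Arg
import Mathlib.Analysis.SpecialFunctions.Trigonometric.Arctan
import Mathlib.Data.Nat.Factorial.BigOperators
import HarnessLib

/-!
# Taylor coefficients at a real point of a function with a real-symmetric pair of poles

Topic `Literature/NumberTheory/LFunctions` (namespace `Literature.NumberTheory.LFunctions`,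
grouping sub-namespace `PolyaSignChanges`).  Part of the A1 formalisation of Pólya's sign-change
theorem in Grosswald's form (`PolyaSignChanges.Grosswald1967_thmB`) by the Descartes–Laguerre
MOMENT METHOD (cell pub/rh-inputs, PieceA; the skeleton's `stub_polePair_taylor` in quantitative
form).  Nothing in this file bears on the truth of RH.

## Content (all proved, sorry-free)

Let `Ψ` be holomorphic on the closed disc `|s − λ| ≤ R'` (`λ` real) except at a conjugate pair
`ρ, ρ̄` with `im ρ > 0`, `R := |λ − ρ| < R'`, real-symmetric (`Ψ(s̄) = conj Ψ(s)`), with a genuine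
pole of order `m ≥ 1` at `ρ`: `(s − ρ)^m Ψ(s) → A ≠ 0`.

* `polePair_decomposition`: `Ψ^{(k)}(λ) = S_k + conj S_k + E^{(k)}(λ)` with `E` holomorphic on the
  open disc `|s − λ| < R'` and `S_k` the termwise derivative of the principal part
  `Σ_{j<m} a_j (s − ρ)^{j−m}` (`a_0 = A`; the `a_j` are iterated divided differences of
  `(s−ρ)^m Ψ` at `ρ`; the mirror pole is handled through the symmetry).
* (sequel file `PolyaSignChangesPolePairAsymptotics.lean`: the real asymptotics
  `(-1)^k Re Ψ^{(k)}(λ)/k! = N_k (cos((m+k)φ + α) + ε_k)`, `ε_k → 0`.)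
* Private plumbing: `iteratedDeriv_conj_conj`, `iteratedDeriv_zpow_neg_sub`,
  `eq_sum_iterate_dslope` (Taylor formula with iterated `dslope`s).

## References

* E. Grosswald, *Oscillation theorems of arithmetical functions*, TAMS 126 (1967) 1–28, §4 Thm B
  (statement of Pólya's theorem; the moment-method proof architecture is the cell's, cf. the
  module docstring of `PolyaSignChanges.lean`). [Grosswald1967]
-/

noncomputable section

open Complex Set Filter Topology Metric Finset

open scoped ComplexConjugate

namespace Literature.NumberTheory.LFunctions

namespace PolyaSignChanges

/-! ### Generic one-variable lemmas -/

/-- `(conj ∘ f ∘ conj)^{(k)} = conj ∘ f^{(k)} ∘ conj`. [folklore] -/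
private theorem iteratedDeriv_conj_conj (f : ℂ → ℂ) (k : ℕ) :
    iteratedDeriv k (fun s => conj (f (conj s))) = fun z => conj (iteratedDeriv k f (conj z)) := by
  induction k generalizing f with
  | zero => simp
  | succ k ih =>
    rw [iteratedDeriv_succ', iteratedDeriv_succ']
    have h1 : (fun s => conj (f (conj s))) = conj ∘ f ∘ conj := rfl
    rw [h1, deriv_conj_conj]
    exact ih (deriv f)

/-- Iterated derivative of a negative power: `((s − ρ)^{-n})^{(k)}(c) =
(-1)^k · n(n+1)⋯(n+k-1) · (c − ρ)^{-(n+k)}`. [folklore] -/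
private theorem iteratedDeriv_zpow_neg_sub (ρ c : ℂ) (n k : ℕ) :
    iteratedDeriv k (fun s : ℂ => (s - ρ) ^ (-(n : ℤ))) c =
      (-1) ^ k * (n.ascFactorial k : ℂ) * (c - ρ) ^ (-((n + k : ℕ) : ℤ)) := by
  rw [iteratedDeriv_comp_sub_const k (fun s : ℂ => s ^ (-(n : ℤ))) ρ]
  simp only
  rw [iteratedDeriv_eq_iterate, iter_deriv_zpow]
  congr 1
  · rw [Nat.ascFactorial_eq_prod_range, Nat.cast_prod]
    have hk : (-1 : ℂ) ^ k = ∏ _i ∈ range k, (-1 : ℂ) := by simp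
    rw [hk, ← prod_mul_distrib]
    refine prod_congr rfl fun i _ => ?_
    push_cast
    ring
  · congr 1
    push_cast
    ring

/-- Taylor's formula with iterated divided differences:
`h(s) = Σ_{j<m} h^{[j]}(ρ) (s−ρ)^j + (s−ρ)^m h^{[m]}(s)`, `h^{[0]} = h`, `h^{[j+1]} = dslope h^{[j]} ρ`.
[folklore] -/
private theorem eq_sum_iterate_dslope (h : ℂ → ℂ) (ρ : ℂ) (m : ℕ) (s : ℂ) :
    h s = ∑ j ∈ range m, ((Function.swap dslope ρ)^[j] h) ρ * (s - ρ) ^ j +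
      (s - ρ) ^ m * ((Function.swap dslope ρ)^[m] h) s := by
  induction m with
  | zero => simp
  | succ m ih =>
    rw [sum_range_succ, Function.iterate_succ_apply']
    have key := sub_smul_dslope ((Function.swap dslope ρ)^[m] h) ρ s
    simp only [smul_eq_mul] at key
    have : Function.swap dslope ρ ((Function.swap dslope ρ)^[m] h) =
        dslope ((Function.swap dslope ρ)^[m] h) ρ := rfl
    rw [this, ih, pow_succ]
    linear_combination -(s - ρ) ^ m * key

/-- Iterated `dslope`s of a holomorphic function stay holomorphic (on a neighbourhood of the
base point). [folklore] -/
private theorem differentiableOn_iterate_dslope {h : ℂ → ℂ} {U : Set ℂ} {ρ : ℂ} (hU : U ∈ 𝓝 ρ)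
    (hh : DifferentiableOn ℂ h U) (j : ℕ) :
    DifferentiableOn ℂ ((Function.swap dslope ρ)^[j] h) U := by
  induction j with
  | zero => simpa using hh
  | succ j ih =>
    rw [Function.iterate_succ_apply']
    exact (Complex.differentiableOn_dslope hU).2 ih

/-! ### The decomposition `Ψ = P + P* + E` and the Taylor coefficients at the real point -/

/-- **Principal parts at a real-symmetric pole pair.**  Let `Ψ` be holomorphic on the closed disc
`|s − λ| ≤ R'` minus a conjugate pair `ρ, ρ̄` (`im ρ > 0`, `|λ − ρ| < R'`), real-symmetric
(`Ψ(s̄) = conj Ψ(s)`), with a genuine pole of order `m` at `ρ` (`(s−ρ)^m Ψ(s) → A`).  Then there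
are Laurent data `a₀ = A, a₁, …` and a function `E` holomorphic on the whole open disc
`|s − λ| < R'` such that for every `k` the `k`-th derivative of `Ψ` at `λ` is
`S_k + conj S_k + E^{(k)}(λ)`, `S_k = Σ_{j<m} a_j (−1)^k (m−j)(m−j+1)⋯(m−j+k−1) (λ−ρ)^{-(m−j+k)}`
(termwise differentiation of the principal parts `Σ a_j (s−ρ)^{j−m}` and its mirror image).
[cite: Grosswald1967, §4 Thm B (moment method: pole-pair asymptotics of the Taylor coefficients)] -/
theorem polePair_decomposition {Ψ : ℂ → ℂ} {lam R' : ℝ} {ρ A : ℂ} {m : ℕ}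
    (him : 0 < ρ.im) (hR' : ‖(lam : ℂ) - ρ‖ < R')
    (hdiff : DifferentiableOn ℂ Ψ (closedBall (lam : ℂ) R' \ {ρ, conj ρ}))
    (hsymm : ∀ s ∈ closedBall (lam : ℂ) R', Ψ (conj s) = conj (Ψ s))
    (hpole : Tendsto (fun s : ℂ => (s - ρ) ^ m * Ψ s) (𝓝[≠] ρ) (𝓝 A)) :
    ∃ (a : ℕ → ℂ) (E : ℂ → ℂ), a 0 = A ∧ DifferentiableOn ℂ E (ball (lam : ℂ) R') ∧
      ∀ k : ℕ, iteratedDeriv k Ψ (lam : ℂ) =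
        (∑ j ∈ range m, a j * ((-1) ^ k * ((m - j).ascFactorial k : ℂ) *
            ((lam : ℂ) - ρ)⁻¹ ^ (m - j + k))) +
        conj (∑ j ∈ range m, a j * ((-1) ^ k * ((m - j).ascFactorial k : ℂ) *
            ((lam : ℂ) - ρ)⁻¹ ^ (m - j + k))) +
        iteratedDeriv k E (lam : ℂ) := by
  set c : ℂ := (lam : ℂ) with hc_def
  set R : ℝ := ‖c - ρ‖ with hR_def
  have hcρ_im : (c - ρ).im = -ρ.im := by simp [hc_def]
  have hR0 : 0 < R := by
    have : c - ρ ≠ 0 := fun h => by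
      have := congrArg Complex.im h; simp [hcρ_im] at this; linarith
    simpa [hR_def] using this
  have hR'0 : 0 < R' := hR0.trans hR'
  have hconjρ : conj ρ ≠ ρ := fun h => by
    have := congrArg Complex.im h; simp at this; linarith
  have hdist_conj : dist (conj ρ) ρ = 2 * ρ.im := by
    rw [Complex.dist_eq]
    have : conj ρ - ρ = ((-(2 * ρ.im) : ℝ) : ℂ) * I := by
      apply Complex.ext <;> simp; ring
    rw [this, norm_mul, Complex.norm_I, mul_one, Complex.norm_real, Real.norm_eq_abs,
      abs_of_neg (by linarith)]
    ring
  -- Step 1: the open punctured disc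
  set V : Set ℂ := ball c R' \ {ρ, conj ρ} with hV_def
  have hVopen : IsOpen V := isOpen_ball.sdiff (Set.toFinite _).isClosed
  have hΨV : DifferentiableOn ℂ Ψ V := hdiff.mono (Set.sdiff_subset_sdiff_left ball_subset_closedBall)
  -- Step 2: a small disc `U` about `ρ` and the regularised `h = (s-ρ)^m Ψ`
  set r₁ : ℝ := min (R' - R) ρ.im with hr₁_def
  have hr₁ : 0 < r₁ := lt_min (by linarith) him
  set U : Set ℂ := ball ρ r₁ with hU_def
  have hU : U ∈ 𝓝 ρ := ball_mem_nhds ρ hr₁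
  have hU_ball : U ⊆ ball c R' := fun s hs => by
    rw [Metric.mem_ball] at hs ⊢
    have h1 : dist ρ c = R := by rw [Complex.dist_eq, norm_sub_rev]
    have h2 : dist s ρ < R' - R := lt_of_lt_of_le hs (min_le_left _ _)
    calc dist s c ≤ dist s ρ + dist ρ c := dist_triangle _ _ _
      _ < (R' - R) + R := by rw [h1]; linarith
      _ = R' := by ring
  have hU_conj : ∀ s ∈ U, s ≠ conj ρ := fun s hs h => by
    rw [hU_def, Metric.mem_ball, h, hdist_conj] at hs
    linarith [min_le_right (R' - R) ρ.im]
  have hUV : U \ {ρ} ⊆ V := fun s hs =>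
    ⟨hU_ball hs.1, by
      simp only [mem_insert_iff, mem_singleton_iff, not_or]
      exact ⟨hs.2, hU_conj s hs.1⟩⟩
  set h : ℂ → ℂ := Function.update (fun s => (s - ρ) ^ m * Ψ s) ρ A with hh_def
  have hh : DifferentiableOn ℂ h U := by
    refine (Complex.differentiableOn_compl_singleton_and_continuousAt_iff hU).1 ⟨?_, ?_⟩
    · have h1 : DifferentiableOn ℂ (fun s => (s - ρ) ^ m * Ψ s) (U \ {ρ}) :=
        ((differentiableOn_id.sub_const ρ).pow m).mul (hΨV.mono hUV)
      refine h1.congr fun s hs => ?_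
      exact Function.update_of_ne (fun h => hs.2 h) _ _
    · exact continuousAt_update_same.2 hpole
  -- Step 3: iterated divided differences and the principal part at `ρ`
  set hs : ℕ → ℂ → ℂ := fun j => (Function.swap dslope ρ)^[j] h with hhs_def
  have hhs : ∀ j, DifferentiableOn ℂ (hs j) U := fun j => differentiableOn_iterate_dslope hU hh j
  set a : ℕ → ℂ := fun j => hs j ρ with ha_def
  have ha0 : a 0 = A := by simp [ha_def, hhs_def, hh_def]
  set P : ℂ → ℂ := fun s => ∑ j ∈ range m, a j * (s - ρ) ^ (-((m - j : ℕ) : ℤ)) with hP_def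
  have hΨP : ∀ s ∈ U, s ≠ ρ → Ψ s = P s + hs m s := by
    intro s hsU hsρ
    have e := eq_sum_iterate_dslope h ρ m s
    have hne : s - ρ ≠ 0 := sub_ne_zero.2 hsρ
    have hhs' : h s = (s - ρ) ^ m * Ψ s := Function.update_of_ne hsρ _ _
    have hΨ : Ψ s = ((s - ρ) ^ m)⁻¹ * h s := by
      rw [hhs', ← mul_assoc, inv_mul_cancel₀ (pow_ne_zero m hne), one_mul]
    rw [hΨ, e, mul_add, ← mul_assoc, inv_mul_cancel₀ (pow_ne_zero m hne), one_mul, hP_def,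
      mul_sum]
    congr 1
    refine sum_congr rfl fun j hj => ?_
    have hjm : j ≤ m := (mem_range.1 hj).le
    have : (s - ρ) ^ (-((m - j : ℕ) : ℤ)) = ((s - ρ) ^ m)⁻¹ * (s - ρ) ^ j := by
      rw [show (-((m - j : ℕ) : ℤ)) = (j : ℤ) - (m : ℤ) by push_cast [Nat.cast_sub hjm]; ring,
        zpow_sub₀ hne, zpow_natCast, zpow_natCast, div_eq_mul_inv, mul_comm]
    rw [this]; ring
  have hPdiff : ∀ s, s ≠ ρ → DifferentiableAt ℂ P s := by
    intro s hsρ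
    refine DifferentiableAt.fun_sum fun j _ => ?_
    exact ((differentiableAt_id.sub_const ρ).zpow (Or.inl (sub_ne_zero.2 hsρ))).const_mul _
  -- the mirror principal part and the regular part `E`
  set Pstar : ℂ → ℂ := fun s => conj (P (conj s)) with hPstar_def
  have hPstar_diff : ∀ s, s ≠ conj ρ → DifferentiableAt ℂ Pstar s := by
    intro s hs
    have h1 : conj s ≠ ρ := fun h => hs (by rw [← h, conj_conj])
    have := (hPdiff (conj s) h1).conj_conj
    rwa [conj_conj] at this
  set G : ℂ → ℂ := fun s => hs m s - Pstar s with hG_def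
  have hG : DifferentiableAt ℂ G ρ :=
    ((hhs m).differentiableAt hU).sub (hPstar_diff ρ hconjρ.symm)
  set E : ℂ → ℂ := fun s =>
    if s = ρ then G ρ else if s = conj ρ then conj (G ρ) else Ψ s - P s - Pstar s with hE_def
  have hE_gen : ∀ s, s ≠ ρ → s ≠ conj ρ → E s = Ψ s - P s - Pstar s := fun s h1 h2 => by
    simp [hE_def, h1, h2]
  -- `E` near `ρ`
  have hEρ : E =ᶠ[𝓝 ρ] G := by
    filter_upwards [hU] with s hsU
    by_cases hsρ : s = ρ
    · simp [hE_def, hsρ]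
    · rw [hE_gen s hsρ (hU_conj s hsU), hΨP s hsU hsρ, hG_def]
      ring
  -- `E` near `conj ρ`
  have hEρ' : E =ᶠ[𝓝 (conj ρ)] fun s => conj (G (conj s)) := by
    have hU' : ball (conj ρ) r₁ ∈ 𝓝 (conj ρ) := ball_mem_nhds _ hr₁
    filter_upwards [hU'] with s hsU'
    have hcs : conj s ∈ U := by
      rw [hU_def, Metric.mem_ball, ← Complex.dist_conj_conj, conj_conj]; exact hsU'
    by_cases hsρ : s = conj ρ
    · simp [hE_def, hsρ, hconjρ]
    · have hcsρ : conj s ≠ ρ := fun h => hsρ (by rw [← h, conj_conj])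
      have hs1 : s ≠ ρ := fun h => hU_conj (conj s) hcs (by rw [h])
      have hsball : s ∈ closedBall c R' := by
        have := hU_ball hcs
        rw [Metric.mem_ball, ← Complex.dist_conj_conj, conj_conj, hc_def, Complex.conj_ofReal]
          at this
        exact Metric.mem_closedBall.2 this.le
      have e2 : Ψ s = conj (Ψ (conj s)) := by rw [hsymm s hsball, conj_conj]
      rw [hE_gen s hs1 hsρ, e2, hΨP (conj s) hcs hcsρ, hG_def, hPstar_def]
      simp only [map_add, map_sub, conj_conj]
      ring
  have hE : DifferentiableOn ℂ E (ball c R') := by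
    intro s₀ hs₀
    refine DifferentiableAt.differentiableWithinAt ?_
    by_cases h1 : s₀ = ρ
    · subst h1
      exact hG.congr_of_eventuallyEq hEρ
    · by_cases h2 : s₀ = conj ρ
      · subst h2
        have hG' : DifferentiableAt ℂ (fun s => conj (G (conj s))) (conj ρ) := hG.conj_conj
        exact hG'.congr_of_eventuallyEq hEρ'
      · have hs₀V : s₀ ∈ V := ⟨hs₀, by simp [h1, h2]⟩
        have hΨat : DifferentiableAt ℂ Ψ s₀ := hΨV.differentiableAt (hVopen.mem_nhds hs₀V)
        have hd : DifferentiableAt ℂ (fun s => Ψ s - P s - Pstar s) s₀ :=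
          (hΨat.sub (hPdiff s₀ h1)).sub (hPstar_diff s₀ h2)
        refine hd.congr_of_eventuallyEq ?_
        filter_upwards [isOpen_ne.mem_nhds h1, isOpen_ne.mem_nhds h2] with s hs1 hs2
        exact hE_gen s hs1 hs2
  -- Step 4: on the small disc `|s - λ| < R` we have `Ψ = P + P* + E`
  have hΨeq : Ψ =ᶠ[𝓝 c] fun s => P s + Pstar s + E s := by
    filter_upwards [ball_mem_nhds c hR0] with s hs
    rw [Metric.mem_ball] at hs
    have hs1 : s ≠ ρ := fun h => by
      rw [h, Complex.dist_eq, norm_sub_rev] at hs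
      exact lt_irrefl R hs
    have hs2 : s ≠ conj ρ := fun h => by
      rw [h, ← Complex.dist_conj_conj, conj_conj, hc_def, Complex.conj_ofReal, Complex.dist_eq,
        norm_sub_rev] at hs
      exact lt_irrefl R hs
    rw [hE_gen s hs1 hs2]; ring
  have hcρ : c ≠ ρ := fun h => by
    have := congrArg Complex.im h; simp [hc_def] at this; linarith
  have hcρ' : c ≠ conj ρ := fun h => by
    have := congrArg Complex.im h; simp [hc_def] at this; linarith
  have hPon : DifferentiableOn ℂ P {ρ}ᶜ := fun s hs => (hPdiff s hs).differentiableWithinAt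
  have hPson : DifferentiableOn ℂ Pstar {conj ρ}ᶜ := fun s hs =>
    (hPstar_diff s hs).differentiableWithinAt
  have hPc : ∀ k : ℕ, ContDiffAt ℂ k P c := fun k =>
    (hPon.analyticAt (isOpen_compl_singleton.mem_nhds hcρ)).contDiffAt
  have hPsc : ∀ k : ℕ, ContDiffAt ℂ k Pstar c := fun k =>
    (hPson.analyticAt (isOpen_compl_singleton.mem_nhds hcρ')).contDiffAt
  have hEc : ∀ k : ℕ, ContDiffAt ℂ k E c := fun k =>
    (hE.analyticAt (ball_mem_nhds c hR'0)).contDiffAt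
  -- Step 5: termwise differentiation
  have hPk : ∀ k, iteratedDeriv k P c = ∑ j ∈ range m, a j * ((-1) ^ k *
      ((m - j).ascFactorial k : ℂ) * (c - ρ)⁻¹ ^ (m - j + k)) := by
    intro k
    have : P = fun s => ∑ j ∈ range m, (fun j s => a j * (s - ρ) ^ (-((m - j : ℕ) : ℤ))) j s := rfl
    rw [this, iteratedDeriv_fun_sum]
    · refine sum_congr rfl fun j hj => ?_
      show iteratedDeriv k (fun s => a j * (s - ρ) ^ (-((m - j : ℕ) : ℤ))) c = _
      rw [iteratedDeriv_const_mul_field, iteratedDeriv_zpow_neg_sub, zpow_neg, zpow_natCast,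
        inv_pow]
    · intro j hj
      have hd : DifferentiableOn ℂ (fun s => a j * (s - ρ) ^ (-((m - j : ℕ) : ℤ))) {ρ}ᶜ :=
        fun s hs => (((differentiableAt_id.sub_const ρ).zpow
          (Or.inl (sub_ne_zero.2 hs))).const_mul _).differentiableWithinAt
      exact (hd.analyticAt (isOpen_compl_singleton.mem_nhds hcρ)).contDiffAt
  have hPsk : ∀ k, iteratedDeriv k Pstar c = conj (iteratedDeriv k P c) := by
    intro k
    have := congrFun (iteratedDeriv_conj_conj P k) c
    rw [hPstar_def, this, hc_def, Complex.conj_ofReal]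
  refine ⟨a, E, ha0, hE, fun k => ?_⟩
  rw [hΨeq.iteratedDeriv_eq, iteratedDeriv_fun_add ((hPc k).add (hPsc k)) (hEc k),
    iteratedDeriv_fun_add (hPc k) (hPsc k), hPsk k, hPk k]

end PolyaSignChanges

end Literature.NumberTheory.LFunctions

end
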